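import Summits.FinalStateConjecture.FinalStateConjecture.Theorems.ChannelsResolveTameDevelopmentsR.Negative.SubMinkowskiSettledT2
import Summits.FinalStateConjecture.FinalStateConjecture.Theorems.PhotonSphereChannelsEndVisibleDefs
import HarnessLib

/-!
# NoHidden HOLDS on the flat model class: in a sojourn-complete open sub-development `η|_U` of
# Minkowski space every event on or above the slice is END-VISIBLE — model certificate for the stub
# `stub_noHiddenCompleteRays` of line `Sketch` (crux `ChannelsResolveTameDevelopmentsR`, K2R-T2,
# item `stmt-FinalStateConjecture-17430`, route PhotonSphereChannels), load-bearing analysis on the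
# certifiable model class, part 6

Line `Sketch` (idea `end-visible-rays-quarantine`) splits the crux exactly as
`crux ⇐ NoHiddenCompleteRays ∧ K2REnd` (`Theorems/PhotonSphereChannelsEndVisibleDefs`): the pure
causal-topology half NoHidden says that under the crux's hypotheses every point `γ t`, `t ≥ 0`, of every
future-complete normalised null ray from `Σ` lies in `closure (endVisibleRegion 𝒟)`
(`EndVisible.CompleteRaysNearEndVisible`), where an event is END-VISIBLE
(`EndVisible.IsEndVisibleEvent`) when for every compact `K ⊆ Σ` it lies in the chronological past of a
future-complete normalised null ray launched OUTSIDE `K`. On paper NoHidden is operator-contingent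
(false on `ℝ³ # N`, `σ(N) ≤ 0`, by a hidden expanding vacuum bag); in the tree no certified-maximal
development of any datum exists, so the stub itself is neither provable nor refutable today.

This file certifies NoHidden's CONCLUSION on every model the tree CAN certify — the open
sub-developments `η|_U` of the trivial datum (`subDev`, parts 1–5 `Negative/SubMinkowski*`), for which
complete `𝓘⁺` ⟺ `{x⁰ ≥ 0} ⊆ U` (`hasCompleteNullInfinity_iff_future_subset`):

* `not_bddAbove_of_isNormalisedNullRayFrom` — if `{x⁰ ≥ 0} ⊆ U`, every normalised null ray of `η|_U`
  from the slice is future complete (the per-ray content of `hasCompleteNullInfinity_of_future_subset`);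
* `isEndVisibleEvent_of_time_nonneg` — **if `{x⁰ ≥ 0} ⊆ U`, every event `x` of `η|_U` with `x⁰ ≥ 0`
  is end-visible**: given a compact `K ⊆ ℝ³`, launch from a slice point `y ∉ K` with
  `‖y‖ > x⁰ + ‖x̲‖` the maximal null geodesic aimed at `x̲` (O'Neill's `γ_v`, `v = (1, (x̲ − y)/L)`,
  `L = ‖x̲ − y‖ > x⁰`); it is a normalised null ray, straight (`geodesic_affine`), future complete, and
  passes through `(L, x̲)` at parameter `L ≥ 0`, which lies on the vertical timelike segment from `x`
  inside `{x⁰ ≥ 0} ⊆ U`: `x ≪ γ(L)` within `U`;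
* `futureSet_subset_endVisibleRegion`, `endVisibleRegion_inter_causalFuture_eq_futureSet` — so the
  end-visible region contains the future half-space `O = {x⁰ ≥ 0}`, and to the causal future of the
  data IS it (= the outer region, `TrappedSet.outerRegion`);
* `completeRaysNearEndVisible_of_future_subset`, `completeRaysNearEndVisible_of_hasCompleteNullInfinity`
  — **NoHidden per development holds on every sojourn-complete member of the flat class** (ray points
  with `t ≥ 0` have time coordinate `t ≥ 0`, `raysStayInClosure_futureSet`), maximal or not, (i), (ii)
  idle; `noHidden_subDev` is the stub's implication shape on the class with `IsMaximal` deleted;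
* `exists_not_isMaximal_completeRaysNearEndVisible` — non-vacuity: the past cut `{x⁰ > −1}` is a
  complete, NON-maximal development satisfying NoHidden's conclusion.

So NoHidden is honest and non-vacuous on the certifiable class, and the bag mechanism by which it is
expected to fail needs a second end or non-trivial topology of `Σ` — information no flat model carries.
All results proved; no named facts.

## References

* S. W. Hawking, G. F. R. Ellis, *The large scale structure of space-time* (1973), §6.8, §9.2.
* B. O'Neill, *Semi-Riemannian geometry* (1983), Ch. 3, Prop. 24 (maximal geodesics), Cor. 21 and
  Example 25 (geodesics of `ℝⁿ₁`); Ch. 5, p. 145 and Ch. 14, p. 402 (causal relations of `ℝ⁴₁`).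
* D. Christodoulou, CQG 16 (1999) A23, pp. A26–A27 (normalised rays, complete `𝓘⁺`).
* M. Dafermos, J. Luk, arXiv:1710.01722, Conjecture 1.
* H. Ringström, *The Cauchy problem in general relativity* (2009), Def. 16.5 (MGHD).
-/

noncomputable section

open Bundle Set Function Filter TopologicalSpace Topology MeasureTheory Metric
open scoped Manifold ContDiff Topology ENNReal

-- the problem namespace `Summit.FinalStateConjecture.FinalStateConjecture` repeats a segment by design (D-0022)
set_option linter.dupNamespace false

namespace Summit.FinalStateConjecture.FinalStateConjecture.Theorems.ChannelsResolveTameDevelopmentsR.SubMinkowski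

open Literature.Geometry.Lorentzian Literature.Geometry.Lorentzian.Minkowski
open Summit.FinalStateConjecture.FinalStateConjecture.Theorems.WeakCosmicCensorshipMGHD.Negative
  (dirE3 norm_dirE3)
open Summit.FinalStateConjecture.FinalStateConjecture.Theorems.EndVisible

section EndVisible

variable {U : Opens E4} {hU : IsConnected (U : Set E4)} {hsl : ∀ y : slice, sliceEmbed y ∈ U}
  {hC : (subMetric U).IsCauchyHypersurface (subOrientation U)
    (range (vacuumCauchyDevelopment.embedOpens U hsl))}

/-- **If `{x⁰ ≥ 0} ⊆ U`, every normalised null ray of `η|_U` from the slice is future complete**: the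
ray is straight with `(γ t)⁰ = t` (`geodesic_affine`, normalisation `η(γ'(0), ∂ₜ) = −1`), so a finite
future end `b = sup dom > 0` of its affine domain would put the line point `γ(0) + b γ'(0)`, of time
`b ≥ 0`, in `U` — impossible for a maximal geodesic (`false_of_line_mem_at_closure_point`). The per-ray
content of `hasCompleteNullInfinity_of_future_subset` (adapted from its proof).
[cite: Christodoulou1999, p. A27] -/
theorem not_bddAbove_of_isNormalisedNullRayFrom (hfut : {x : E4 | 0 ≤ x 0} ⊆ (U : Set E4))
    [hLC : (subDev U hU hsl hC).metric.HasLeviCivita] {y : slice}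
    {γ : ℝ → (subDev U hU hsl hC).carrier} {dom : Set ℝ}
    (hray : (subDev U hU hsl hC).metric.IsNormalisedNullRayFrom (subDev U hU hsl hC).timeOrientation
      (subDev U hU hsl hC).embed (subDev U hU hsl hC).normal y γ dom) :
    ¬ BddAbove dom := by
  -- adapted from `hasCompleteNullInfinity_of_future_subset` (Negative/SubMinkowskiCompleteness)
  intro hbdd
  haveI : (subMetric U).toPseudoRiemannianMetric.HasLeviCivita := hLC
  change ℝ → U at γ
  obtain ⟨hmax, h0, hγ0, -, -, hnorm⟩ := hray
  change IsMaximalGeodesicOn (subMetric U).toPseudoRiemannianMetric.leviCivita γ dom at hmax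
  obtain ⟨v, hv, -, -⟩ := geodesic_affine hmax.isGeodesicOn hmax.isOpen hmax.2.1 h0
  -- normalisation: `v⁰ = 1`
  have hv0 : v 0 = 1 := by
    have h' : bilin (velocity 𝓘(ℝ, E4) γ 0) (E4.basisVector 0) = -1 := hnorm
    rw [hv, bilin_symm, bilin_basisVector_zero_left] at h'
    linarith
  -- the future end `b = sup dom` is a positive closure point outside `dom`
  have hne : dom.Nonempty := ⟨0, h0⟩
  set b : ℝ := sSup dom with hb
  obtain ⟨ε, hε, hball⟩ := Metric.mem_nhds_iff.1 (hmax.isOpen.mem_nhds h0)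
  have hεdom : ε / 2 ∈ dom := hball (by
    rw [Metric.mem_ball, Real.dist_eq, sub_zero, abs_of_pos (half_pos hε)]; exact half_lt_self hε)
  have hbpos : 0 < b := (half_pos hε).trans_le (le_csSup hbdd hεdom)
  have hbcl : b ∈ closure dom := csSup_mem_closure hne hbdd
  have hbn : b ∉ dom := fun hbd ↦ by
    obtain ⟨ε', hε', hball'⟩ := Metric.mem_nhds_iff.1 (hmax.isOpen.mem_nhds hbd)
    have h1 : b + ε' / 2 ∈ dom := hball' (by
      rw [Metric.mem_ball, Real.dist_eq, add_sub_cancel_left, abs_of_pos (half_pos hε')]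
      exact half_lt_self hε')
    have := le_csSup hbdd h1
    linarith
  -- the line point at `b` has time `b ≥ 0`, hence lies in `U`: impossible
  have hmem : (γ 0 : E4) + b • v ∈ (U : Set E4) := by
    refine hfut ?_
    show 0 ≤ ((γ 0 : E4) + b • v) 0
    have h00 : (γ 0 : E4) 0 = 0 := by rw [hγ0]; rfl
    have : ((γ 0 : E4) + b • v) 0 = (γ 0 : E4) 0 + b * v 0 := by simp
    rw [this, h00, hv0]
    linarith
  exact false_of_line_mem_at_closure_point hmax h0 hv hbcl hbn hmem

open Classical in
/-- **IF `{x⁰ ≥ 0} ⊆ U`, EVERY EVENT OF `η|_U` ON OR ABOVE THE SLICE IS END-VISIBLE.** Let `x ∈ U`,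
`x⁰ ≥ 0`, and let `K ⊆ ℝ³` be compact, `K ⊆ B̄(0, R₁)`. Pick the slice point `y = r e₃`,
`r = max (x⁰ + ‖x̲‖) |R₁| + 1`, so `y ∉ K` and `L := ‖x̲ − y‖ ≥ ‖y‖ − ‖x̲‖ > x⁰ ≥ 0`; let `γ` be the
maximal geodesic of `η|_U` from `ι y = (0, y)` with the null velocity `v = (1, e)`, `e = (x̲ − y)/L`
(O'Neill's `γ_v`, `exists_isMaximalGeodesicOn`). It is a normalised future null ray from `y`
(`η(v, v) = 0`, `η(∂ₜ, v) = −1`), future complete (`not_bddAbove_of_isNormalisedNullRayFrom`), and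
straight: `γ(t) = (t, y + t e)` (`geodesic_affine`), so `L ∈ dom` and `γ(L) = (L, x̲) = x + (L − x⁰) ∂ₜ`.
The vertical segment `σ ↦ x + σ (L − x⁰) ∂ₜ`, `σ ∈ [0, 1]`, is a future timelike curve of Minkowski
space (`isFutureTimelikeCurveOn_line`) lying in `{x⁰ ≥ 0} ⊆ U`, hence lifts to `η|_U`
(`isFutureTimelikeCurveOn_lift`): `x ≪ γ(L)` within `U`, i.e. `x ∈ I⁻(γ(dom ∩ [0, ∞)))`.
[cite: HawkingEllis1973, §9.2] -/
theorem isEndVisibleEvent_of_time_nonneg (hfut : {x : E4 | 0 ≤ x 0} ⊆ (U : Set E4))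
    [hLC : (subDev U hU hsl hC).metric.HasLeviCivita] {x : U} (hx : 0 ≤ (x : E4) 0) :
    IsEndVisibleEvent (subDev U hU hsl hC).toCauchyDevelopment x := by
  intro K hK
  haveI hLC' : (subMetric U).toPseudoRiemannianMetric.HasLeviCivita := hLC
  haveI : CovariantDerivative.ContMDiffCovariantDerivative
      (subMetric U).toPseudoRiemannianMetric.leviCivita 1 :=
    ⟨(subMetric U).toPseudoRiemannianMetric.isLocallyContMDiff_leviCivita_holds 1
      (by rw [show ((1 : ℕ∞) : ℕ∞ω) + 1 = 2 by norm_num]; exact WithTop.coe_le_coe.2 le_top)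
      univ isOpen_univ⟩
  -- `K` is bounded
  obtain ⟨R₁, hR₁⟩ := (Metric.isBounded_iff_subset_closedBall (0 : E3)).1
    (hK.image continuous_subtype_val).isBounded
  -- a far slice point `y ∉ K` with `‖y‖ > x⁰ + ‖x̲‖`
  set R₀ : ℝ := (x : E4) 0 + ‖E4.spatial (x : E4)‖ with hR₀
  set r : ℝ := max R₀ |R₁| + 1 with hr
  have hr0 : 0 ≤ r := by
    have : 0 ≤ max R₀ |R₁| := (abs_nonneg R₁).trans (le_max_right _ _)
    linarith
  set y : slice := ⟨r • dirE3, mem_slice _⟩ with hy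
  have hyn : ‖(y : E3)‖ = r := by
    show ‖r • dirE3‖ = r
    rw [norm_smul, norm_dirE3, mul_one, Real.norm_eq_abs, abs_of_nonneg hr0]
  have hyK : y ∉ K := fun hyK ↦ by
    have h1 := hR₁ ⟨y, hyK, rfl⟩
    rw [Metric.mem_closedBall, dist_zero_right, hyn] at h1
    have : |R₁| < r := by
      have := le_max_right R₀ |R₁|; linarith
    linarith [le_abs_self R₁]
  have hyR : R₀ < ‖(y : E3)‖ := by rw [hyn]; have := le_max_left R₀ |R₁|; linarith
  -- the aiming direction `e = (x̲ - y)/L`, `L = ‖x̲ - y‖ > x⁰ ≥ 0`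
  set d : E3 := E4.spatial (x : E4) - (y : E3) with hd
  set L : ℝ := ‖d‖ with hL
  have hLge : ‖(y : E3)‖ - ‖E4.spatial (x : E4)‖ ≤ L := by
    rw [hL, hd, norm_sub_rev]
    exact norm_sub_norm_le _ _
  have hLx : (x : E4) 0 < L := by rw [hR₀] at hyR; linarith
  have hLpos : 0 < L := lt_of_le_of_lt hx hLx
  set e : E3 := L⁻¹ • d with he
  have hen : ‖e‖ = 1 := by
    rw [he, norm_smul, norm_inv, Real.norm_eq_abs, abs_of_pos hLpos, ← hL, inv_mul_cancel₀ hLpos.ne']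
  have hLe : L • e = d := by rw [he, smul_smul, mul_inv_cancel₀ hLpos.ne', one_smul]
  set v : E4 := E4.ofTimeSpace 1 e with hv
  have hv0 : v 0 = 1 := E4.ofTimeSpace_apply_zero 1 e
  have hvs : E4.spatial v = e := E4.spatial_ofTimeSpace 1 e
  have hvnull : bilin v v = 0 := by
    rw [C0Extension.bilin_self_eq, hvs, hen, hv0]; norm_num
  have hvne : v ≠ 0 := fun h0 ↦ by
    have := congrArg (fun u : E4 ↦ u 0) h0
    rw [hv0] at this
    simp at this
  have hve₀ : bilin (E4.basisVector 0) v = -1 := by rw [bilin_basisVector_zero_left, hv0]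
  -- the maximal null geodesic of `η|_U` from `ι y` with velocity `v`
  set p₀ : U := vacuumCauchyDevelopment.embedOpens U hsl y with hp₀
  have hp₀val : (p₀ : E4) = E4.ofTimeSpace 0 (y : E3) := rfl
  obtain ⟨γ, dom, hmax, h0, hγ0, hvel, -⟩ :=
    exists_isMaximalGeodesicOn (cov := (subMetric U).toPseudoRiemannianMetric.leviCivita) p₀ v
  -- it is a normalised future null ray of the sub-development from `y`
  have hray : (subDev U hU hsl hC).metric.IsNormalisedNullRayFrom (subDev U hU hsl hC).timeOrientation
      (subDev U hU hsl hC).embed (subDev U hU hsl hC).normal y γ dom := by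
    refine ⟨hmax, h0, hγ0, ?_, ?_, ?_⟩
    · change bilin (velocity 𝓘(ℝ, E4) γ 0) (velocity 𝓘(ℝ, E4) γ 0) = 0 ∧ velocity 𝓘(ℝ, E4) γ 0 ≠ 0
      rw [hvel]; exact ⟨hvnull, hvne⟩
    · change (bilin (velocity 𝓘(ℝ, E4) γ 0) (velocity 𝓘(ℝ, E4) γ 0) ≤ 0 ∧ velocity 𝓘(ℝ, E4) γ 0 ≠ 0) ∧
        bilin (E4.basisVector 0) (velocity 𝓘(ℝ, E4) γ 0) < 0
      rw [hvel, hve₀]; exact ⟨⟨hvnull.le, hvne⟩, by norm_num⟩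
    · change bilin (velocity 𝓘(ℝ, E4) γ 0) (E4.basisVector 0) = -1
      rw [hvel, bilin_symm, hve₀]
  -- it is future complete
  have hunb : ¬ BddAbove dom := not_bddAbove_of_isNormalisedNullRayFrom hfut hray
  -- it is straight
  obtain ⟨v', hv', -, hline⟩ := geodesic_affine hmax.isGeodesicOn hmax.isOpen hmax.2.1 h0
  have hvv : v' = v := hv'.symm.trans hvel
  have hlineE : ∀ t ∈ dom, (γ t : E4) = E4.ofTimeSpace 0 (y : E3) + t • v := fun t ht ↦ by
    rw [hline t ht, hγ0, hp₀val, hvv]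
  -- `L ∈ dom`: the domain is an interval containing `0`, unbounded above
  have hLdom : L ∈ dom := by
    obtain ⟨t₁, ht₁, hLt₁⟩ : ∃ t₁ ∈ dom, L < t₁ := by
      by_contra hcon
      push Not at hcon
      exact hunb ⟨L, fun t ht ↦ hcon t ht⟩
    exact hmax.2.1.out h0 ht₁ ⟨hLpos.le, hLt₁.le⟩
  -- the ray point `γ L = (L, x̲) = x + (L - x⁰) ∂ₜ`
  set s : ℝ := L - (x : E4) 0 with hs_def
  have hs : 0 < s := by rw [hs_def]; linarith
  set w : E4 := s • E4.basisVector 0 with hw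
  have hzval : (γ L : E4) = (x : E4) + w := by
    rw [hlineE L hLdom, hw, hv]
    ext i
    refine Fin.cases ?_ (fun j ↦ ?_) i
    · simp [hs_def]
    · have hj : (E4.ofTimeSpace 0 (y : E3) + L • E4.ofTimeSpace 1 e) j.succ = (y : E3) j + L * e j := by
        simp
      have hj' : ((x : E4) + s • E4.basisVector 0) j.succ = (x : E4) j.succ := by
        simp [Fin.succ_ne_zero]
      rw [hj, hj']
      have hcomp := congrArg (fun u : E3 ↦ u j) hLe
      simp only [hd, PiLp.smul_apply, smul_eq_mul, PiLp.sub_apply, E4.spatial_apply] at hcomp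
      linarith
  -- the vertical timelike segment from `x` to `γ L`, inside `{x⁰ ≥ 0} ⊆ U`
  have hw0 : w 0 = s := by simp [hw]
  have hws : ‖E4.spatial w‖ < w 0 := by
    rw [hw, map_smul, C0Extension.spatial_basisVector_zero, smul_zero, norm_zero, ← hw, hw0]
    exact hs
  set ℓ : ℝ → E4 := fun σ ↦ (x : E4) + σ • w with hℓ
  have hℓc : Continuous ℓ := continuous_const.add (continuous_id.smul continuous_const)
  have hℓM : spacetime.metric.IsFutureTimelikeCurveOn spacetime.timeOrientation ℓ (Icc 0 1) :=
    isFutureTimelikeCurveOn_line hws _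
  have htime : ∀ σ, ℓ σ 0 = (x : E4) 0 + σ * s := fun σ ↦ by simp [hℓ, hw]
  have hmem : ∀ σ ∈ Icc (0 : ℝ) 1, ℓ σ ∈ (U : Set E4) := fun σ hσ ↦ hfut (by
    show 0 ≤ ℓ σ 0
    rw [htime]
    nlinarith [hσ.1])
  set c : ℝ → U := fun σ ↦ if h : ℓ σ ∈ (U : Set E4) then (⟨ℓ σ, h⟩ : U) else x with hc
  have hc0 : c 0 = x := Subtype.ext (by rw [hc, lift_val (hmem 0 ⟨le_rfl, zero_le_one⟩)]; simp [hℓ])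
  have hc1 : c 1 = γ L := Subtype.ext (by
    rw [hc, lift_val (hmem 1 ⟨zero_le_one, le_rfl⟩), hzval]
    simp [hℓ])
  have h1 : γ L ∈ (subMetric U).chronologicalFuture (subOrientation U) {x} :=
    ⟨x, rfl, c, 0, 1, zero_lt_one, isFutureTimelikeCurveOn_lift hℓc hℓM hmem x, hc0, hc1⟩
  have hzimg : γ L ∈ γ '' (dom ∩ Ici 0) := ⟨L, ⟨hLdom, hLpos.le⟩, rfl⟩
  have hpast : x ∈ (subMetric U).chronologicalPast (subOrientation U) (γ '' (dom ∩ Ici 0)) :=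
    LorentzianMetric.chronologicalFuture_mono (singleton_subset_iff.mpr hzimg)
      (LorentzianMetric.mem_chronologicalPast_of_mem_chronologicalFuture h1)
  exact ⟨y, hyK, γ, dom, hray, hunb, hpast⟩

/-- **If `{x⁰ ≥ 0} ⊆ U`, the future half-space `O = {x⁰ ≥ 0}` of `η|_U` is end-visible**:
`futureSet U ⊆ endVisibleRegion`. [cite: HawkingEllis1973, §9.2] -/
theorem futureSet_subset_endVisibleRegion (hfut : {x : E4 | 0 ≤ x 0} ⊆ (U : Set E4))
    [(subDev U hU hsl hC).metric.HasLeviCivita] :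
    futureSet U ⊆ endVisibleRegion (subDev U hU hsl hC).toCauchyDevelopment :=
  fun _ hx ↦ isEndVisibleEvent_of_time_nonneg hfut hx

/-- **If `{x⁰ ≥ 0} ⊆ U`, the end-visible region of `η|_U` to the causal future of the data IS the
future half-space** `{x⁰ ≥ 0}` (`⊇`: `futureSet_subset_endVisibleRegion` and
`mem_causalFuture_range_of_time_nonneg`; `⊆`: causal curves from the slice raise `x⁰`,
`time_nonneg_of_mem_causalFuture_range`) — so on the flat class the end-visible region, the outer
region `TrappedSet.outerRegion` and the settled region `O` of `subDecomp` all coincide above `Σ`.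
[cite: HawkingEllis1973, §9.2] -/
theorem endVisibleRegion_inter_causalFuture_eq_futureSet (hfut : {x : E4 | 0 ≤ x 0} ⊆ (U : Set E4))
    [(subDev U hU hsl hC).metric.HasLeviCivita] :
    endVisibleRegion (subDev U hU hsl hC).toCauchyDevelopment ∩
        (subMetric U).causalFuture (subOrientation U) (range (vacuumCauchyDevelopment.embedOpens U hsl)) =
      futureSet U := by
  refine Subset.antisymm (fun x hx ↦ ?_) fun x hx ↦ ?_
  · exact time_nonneg_of_mem_causalFuture_range (hsl := hsl) hx.2
  · exact ⟨futureSet_subset_endVisibleRegion hfut hx, mem_causalFuture_range_of_time_nonneg hfut hx⟩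

/-- **NoHIDDEN PER DEVELOPMENT HOLDS ON `η|_U` WHEN `{x⁰ ≥ 0} ⊆ U`**: every point `γ t`, `t ≥ 0`, of
every future-complete normalised null ray from the slice lies in `closure (endVisibleRegion)` — indeed
in the end-visible region itself: the ray point has time coordinate `t ≥ 0`
(`raysStayInClosure_futureSet`: rays are straight with unit time component) and the future half-space
is end-visible (`futureSet_subset_endVisibleRegion`). [cite: DafermosLuk2017, Conjecture 1] -/
theorem completeRaysNearEndVisible_of_future_subset (hfut : {x : E4 | 0 ≤ x 0} ⊆ (U : Set E4)) :
    CompleteRaysNearEndVisible (subDev U hU hsl hC).toCauchyDevelopment := by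
  intro hLC y γ dom hray hunb t ht ht0
  exact closure_mono (futureSet_subset_endVisibleRegion hfut)
    (raysStayInClosure_futureSet (hU := hU) (hsl := hsl) (hC := hC) y γ dom hray hunb t ht ht0)

/-- **NoHIDDEN PER DEVELOPMENT HOLDS ON EVERY SOJOURN-COMPLETE MEMBER OF THE FLAT CLASS** (maximal or
not): complete `𝓘⁺` forces `{x⁰ ≥ 0} ⊆ U` (`hasCompleteNullInfinity_iff_future_subset`), and then
`completeRaysNearEndVisible_of_future_subset`. The conclusion of `stub_noHiddenCompleteRays` on the
certifiable model class, from completeness alone. [cite: Christodoulou1999, pp. A26–A27] -/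
theorem completeRaysNearEndVisible_of_hasCompleteNullInfinity
    (h : _root_.Summit.FinalStateConjecture.HasCompleteNullInfinity (subDev U hU hsl hC).toCauchyDevelopment) :
    CompleteRaysNearEndVisible (subDev U hU hsl hC).toCauchyDevelopment :=
  completeRaysNearEndVisible_of_future_subset (hasCompleteNullInfinity_iff_future_subset.1 h)

/-- **The stub `stub_noHiddenCompleteRays` WITH `IsMaximal` DELETED holds on the flat model class**:
for every open sub-development `η|_U` of the trivial datum, complete `𝓘⁺` ⟹ ((i) ∧ (ii) ⟹ NoHidden),
hypotheses (i) `TrappedSet.NoExtremalRemnant`, (ii) `TrappedSet.TameOuterRegion` idle. So on the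
certifiable class NoHidden is honest (its conclusion is MET, not dodged), and a refutation of the stub
must use a development outside this class (a second end or non-trivial topology of `Σ`).
[cite: DafermosLuk2017, Conjecture 1] -/
theorem noHidden_subDev
    (h : _root_.Summit.FinalStateConjecture.HasCompleteNullInfinity (subDev U hU hsl hC).toCauchyDevelopment)
    (_hyp : TrappedSet.NoExtremalRemnant (subDev U hU hsl hC) ∧ TrappedSet.TameOuterRegion (subDev U hU hsl hC)) :
    CompleteRaysNearEndVisible (subDev U hU hsl hC).toCauchyDevelopment :=
  completeRaysNearEndVisible_of_hasCompleteNullInfinity h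

end EndVisible

/-- **NON-VACUITY: THE FLAT CLASS CONTAINS COMPLETE, NON-MAXIMAL DEVELOPMENTS SATISFYING NoHIDDEN.** The
past cut `{x⁰ > −1}` of Minkowski space (`pastCutDev`) is a vacuum Cauchy development of the admissible
trivial datum which is NOT maximal (`pastCutDev_not_isMaximal`), has complete `𝓘⁺`
(`hasCompleteNullInfinity_pastCutDev`) and satisfies NoHidden per development — NoHidden's conclusion
on the certifiable class is carried by completeness, not by maximality. [cite: Ringstrom2009, Def. 16.5] -/
theorem exists_not_isMaximal_completeRaysNearEndVisible :
    ∃ 𝒟 : VacuumCauchyDevelopment trivialData, ¬ 𝒟.IsMaximal ∧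
      _root_.Summit.FinalStateConjecture.HasCompleteNullInfinity 𝒟.toCauchyDevelopment ∧
        CompleteRaysNearEndVisible 𝒟.toCauchyDevelopment :=
  ⟨pastCutDev, pastCutDev_not_isMaximal, hasCompleteNullInfinity_pastCutDev,
    completeRaysNearEndVisible_of_hasCompleteNullInfinity hasCompleteNullInfinity_pastCutDev⟩

end Summit.FinalStateConjecture.FinalStateConjecture.Theorems.ChannelsResolveTameDevelopmentsR.SubMinkowski

end
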